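import Summits.QuantumFields.YangMills.Theorems.LuscherReductionOneSiteLevelsVariational
import Literature.MathematicalPhysics.QuantumFieldTheory.StrongCouplingActivities

/-!
# `‖ψ‖² > 0` for continuous physical test functions that do not vanish identically
# (support module for the registered stub `stub_absLower` of crux `OneSiteLevels`, route `LuscherReduction`, item stmt-QuantumFields-20007;
# fleet lead prover ym-luscher-20007-p1)

The lower-bound door `le_levelValue_of_subspace` (`Theorems/LuscherReductionOneSiteLevelsVariational.lean`) asks that every non-zero element
of the trial space have `‖ψ‖² = l2 ψ ψ > 0` — automatic for CONTINUOUS trial functions because the configuration measure (a finite product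
of Haar probability measures) charges every non-empty open set.  This module records exactly that, for every compact gauge group and every
lattice size: `configMeasure.isOpenPosMeasure`, `l2_self_pos_of_continuous` (a continuous physical `ψ` with `ψ U₀ ≠ 0` has `0 < l2 ψ ψ`), and
the span form `l2_self_pos_of_continuous_ne_zero` (`ψ ≠ 0` as a function suffices).

## WHAT THIS IS NOT
NOT the crux, NOT THE CLAY GAP.  Sorry-free; no new definition, no named fact.
-/

set_option autoImplicit false

noncomputable section

open MeasureTheory Filter Topology Real
open Literature.MathematicalPhysics.QuantumFieldTheory
open Literature.MathematicalPhysics.QuantumLattice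

namespace Summit.QuantumFields.YangMills.Theorems.FemtoTransferGap

section L2Pos

variable {G : Type*} [Group G] [TopologicalSpace G] [IsTopologicalGroup G] [CompactSpace G]
  [MeasurableSpace G] [BorelSpace G]

/-- The configuration measure charges non-empty open sets (finite product of Haar probability measures). [folklore] -/
theorem configMeasure_isOpenPosMeasure (L : ℕ) [NeZero L] : (configMeasure G L).IsOpenPosMeasure := by
  unfold configMeasure
  infer_instance

/-- **A continuous physical test function that does not vanish identically has `‖ψ‖² > 0`.** [folklore] -/
theorem l2_self_pos_of_continuous {L : ℕ} [NeZero L] {ψ : GaugeConfig 3 L G → ℝ} (hψ : IsPhys ψ) (hψc : Continuous ψ)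
    {U₀ : GaugeConfig 3 L G} (h0 : ψ U₀ ≠ 0) : 0 < l2 ψ ψ := by
  haveI := configMeasure_isOpenPosMeasure (G := G) L
  unfold l2
  have hnn : 0 ≤ fun U => ψ U * ψ U := fun U => mul_self_nonneg _
  rw [integral_pos_iff_support_of_nonneg hnn (hψ.integrable_mul hψ)]
  have hopen : IsOpen (Function.support fun U => ψ U * ψ U) := by
    rw [Function.support]
    exact isOpen_ne_fun (hψc.mul hψc) continuous_const
  exact hopen.measure_pos _ ⟨U₀, by simp [Function.mem_support, h0]⟩

/-- Span form: a continuous physical `ψ ≠ 0` has `‖ψ‖² > 0` (the hypothesis `hl2` of `le_levelValue_of_subspace` for spaces of continuous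
trial functions). [folklore] -/
theorem l2_self_pos_of_continuous_ne_zero {L : ℕ} [NeZero L] {ψ : GaugeConfig 3 L G → ℝ} (hψ : IsPhys ψ) (hψc : Continuous ψ)
    (hne : ψ ≠ 0) : 0 < l2 ψ ψ := by
  obtain ⟨U₀, h0⟩ : ∃ U₀, ψ U₀ ≠ 0 := by
    by_contra h
    push Not at h
    exact hne (funext h)
  exact l2_self_pos_of_continuous hψ hψc h0

end L2Pos

end Summit.QuantumFields.YangMills.Theorems.FemtoTransferGap

end
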